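import Summits.CriticalPhenomena.SAWScalingLimit.Theses.SAWTargetMonotonicity
import Literature.Probability.RandomPlanarGeometry.SAWTargetOrder

/-!
# Line `birth` — registered skeleton for the crux `TargetMonotone` (stmt-CriticalPhenomena-8253)

Crux (FIXED; rank 2 of `route-CriticalPhenomena-SAWTargetMonotonicity`, "the polymer aims"): at
`x = x_c` the critical square-lattice SAW chord law of the lattice domain
`Ω = {wind C ≠ 0} ∩ D.carrier` (`C = P·Q·R` a counter-clockwise closed lattice walk, `D` a Jordan
domain), from the source `a` (attached at the junction `a*` of `R` and `P`) is STOCHASTICALLY MONOTONE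
IN ITS TARGET, in Hall/Strassen form: for the targets `b` (attached at `b* = P ∩ Q`) before `c`
(attached at `c* = Q ∩ R`) and every set `A` of chords `a → b`,
`law_{a,b}(A) ≤ law_{a,c}{γ' | ∃ γ ∈ A, γ' weakly beyond γ}` where "weakly beyond" means the target loop
`γ · (b,b*) · Q · (c*,c) · γ'⁻¹` winds non-negatively around every point.  By
`SAW.isTargetOrdered_latticeConnector_iff` (`Literature/…/SAWTargetOrder.lean`, PROVED) the conclusion is,
word for word, `SAW.IsTargetOrdered Ω δ a b c (SAW.latticeConnector δ Q)`, i.e.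
`StochDominatedAlong (SAW.WeaklyBeyond κ) (law Ω δ a b) (law Ω δ a c)` with `κ` the mesh points of `Q`.

## The line: FIRST-STEP RECURSION (Karlin–McGregor / MLR mechanism, in Hall form)

Decompose both chord laws according to the FIRST DART of the walk at the source.  The four darts at
`a` are indexed `k = 0,1,2,3` counter-clockwise starting from the boundary dart `d₀ = a* − a`:
`d_k = rot90^k d₀` (`rot90 (x, y) = (−y, x)`); no chord uses `d₀` (`a* ∈ C` is not a vertex of
`Ω_δ`), and after inserting the spike `a* → a` into the counter-clockwise boundary the neighbours of
`a` are met in the order `d₃, d₂, d₁`, then `b`, then `c`.  Hence (planar non-crossing) the chord to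
the FARTHER target `c` prefers LARGER dart indices, and "`γ'` weakly beyond `γ`" forces
`index γ ≤ index γ'` near the source.  The typed index of a chord is the inlined
`if v₁ = a + d₁ then 1 else if v₁ = a + d₂ then 2 else if v₁ = a + d₃ then 3 else 0` (`v₁` its first
vertex; the junk value `0` is never taken by a chord), written `dartIndex a a*` below.

* S1 `stub_firstStepOrder` (L; the TP₂ INPUT) — FIRST-STEP ORDER: for every `k`,
  `law_{a,b}{index ≥ k} ≤ law_{a,c}{index ≥ k}` (usual stochastic order of the first dart).  It is the
  tail-sum consequence of the 2×2 boundary minors `Z(a+dᵢ→b)·Z(a+dⱼ→c) ≥ Z(a+dᵢ→c)·Z(a+dⱼ→b)`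
  (`i < j`, partition functions in `Ω_δ ∖ {a}`; `weight Ω δ a t {first dart = dᵢ} = x_c · Z(a+dᵢ → t)`
  since a SAW never returns to `a`), which is the relabelled instance `(p₁,p₂,p₃,p₄) = (a+dᵢ, b, c, a+dⱼ)`
  of crux `SAWTotalPositivity.BoundaryTP2` (stmt-CriticalPhenomena-7115, the route header's "KernelTP2":
  "the conjecture of card totally-positive-polymer restricted to boundary minors") in the spiked domain,
  plus the interlacing lemma (cyclic order `dⱼ, dᵢ, b, c` ⇒ every SAW `a+dᵢ → c` meets every SAW
  `b → a+dⱼ`) and reversal symmetry of `weight`.  Also a CONSEQUENCE of the crux for simple `C`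
  (`{index ≥ k}` is an up-set of the weakly-beyond relation: winding bookkeeping at the four cells
  around `a`).  Independently killable by exact enumeration at `x_c` (one 2×2 minor per domain).
* S2 `stub_tailOrder` (XL; HARDEST — the recursion invariant) — TAIL ORDER: for dart indices `i ≤ j`
  the CONDITIONAL chord laws given the first darts, `law_{a,b}(· | index = i)` and
  `law_{a,c}(· | index = j)`, are ordered along the same weakly-beyond relation, in cross-multiplied
  Hall form (junk-safe: no division, trivial when a fibre is null):
  `∀ A ⊆ {index = i}, law_{a,b}(A)·law_{a,c}{index = j} ≤ law_{a,c}(beyond[A] ∩ {index = j})·law_{a,b}{index = i}`.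
  By the exact domain-Markov property the conditional tail given the first dart `dᵢ` is the `x_c`-SAW
  chord of the slit domain `Ω ∖ [a*, a]` from `a + dᵢ`; so the DIAGONAL `i = j` is target monotonicity
  ONE VERTEX DOWN (same relation, the spike `a* → a → a+dᵢ` extending the boundary), and the
  OFF-DIAGONAL `i < j` is its two-source companion (sources `a+dᵢ` before `a+dⱼ` across the spike,
  targets `b` before `c`: the non-crossing pairing).  The natural proof is therefore an induction on
  `|Ω_δ|` in which S1 and S3 are re-used at every step and the two-source statement is carried along
  (the route header's "KernelToTarget … integrated along the domain-Markov exploration"); the place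
  where `DomainMonotone`-type comparisons may be needed is the off-diagonal, after the two walks split.
* S3 `stub_monotoneMixture` (M; PROVABLE NOW, pure measure theory on discrete spaces) — MONOTONE
  MIXTURE LEMMA in Hall form: if `μ = Σᵢ μ|_{f=i}`, `ν = Σⱼ ν|_{g=j}` are finite measures on discrete
  spaces fibred over `Fin n`, the fibre masses are stochastically ordered (`μ{f ≥ k} ≤ ν{g ≥ k}`) and the
  fibres are cross-ordered along `R` for `i ≤ j` (cross-multiplied Hall inequalities), then
  `StochDominatedAlong R μ ν`.  Proof (no Strassen, no coupling): with `cᵢ = μ(A ∩ {f=i})/μ{f=i}`,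
  `eⱼ = ν(R[A] ∩ {g=j})/ν{g=j}` one has `cᵢ ≤ eⱼ` for `i ≤ j`; `m_k := min(1, min_{j ≥ k, ν{g=j}>0} eⱼ)` is
  non-decreasing with `cᵢ ≤ mᵢ`, `mⱼ ≤ eⱼ`; Abel summation against `μ{f ≥ k} ≤ ν{g ≥ k}` gives
  `μ(A) = Σ μ{f=i} cᵢ ≤ Σ μ{f=i} mᵢ ≤ Σ ν{g=j} mⱼ ≤ Σ ν(R[A] ∩ {g=j}) ≤ ν(R[A])`.  Karlin's
  "TP₂ kernels preserve stochastic order" step, abstracted; lands as a `Theorems/` lemma (or Literature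
  folklore API next to `StochDominatedAlong.trans`).

`TargetMonotone_of` (kernel-checked, no `sorry` of its own): introduce the crux's data and hypotheses,
feed them to S1 and S2, apply S3 with `R = SAW.WeaklyBeyond (SAW.latticeConnector δ Q)`,
`μ = law Ω δ a b`, `ν = law Ω δ a c`, `f = g = dartIndex a a*` (total masses of `SAW.law` are `≤ 1`,
`law_univ_ne_top`), and rewrite the resulting `SAW.IsTargetOrdered …` into the crux's inlined conclusion
by `SAW.isTargetOrdered_latticeConnector_iff`.  Hypotheses = the three stubs under their registered
names (`Registered.stub_…`); conclusion = the route decl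
`Summit.CriticalPhenomena.SAWScalingLimit.Theses.SAWTargetMonotonicity.TargetMonotone` BY NAME.

S1 and S2 are stated over the crux's data class VERBATIM (same binders and hypotheses as `TargetMonotone`,
minus the unused `hle`), in tree vocabulary only (`SAW.law`, `SAW.DomainSAW`, `SAW.WeaklyBeyond`,
`SAW.latticeConnector`, the inlined dart index), so each lands verbatim as
`Theorems/SAWTargetMonotonicityTargetMonotone<Stub>.lean --supports stmt-CriticalPhenomena-8253`.
Degenerate members of the typed class (corridor-pinched `C` for which `{wind C = 0}` is disconnected,
attachments "straight behind" at non-tips, Jordan domains `D` slicing `{wind C ≠ 0}` into several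
components) are typing artefacts SHARED with the crux, not introduced here.

Disproof / negatives: no `Cruxes/TargetMonotone/Disproof.lean` exists (`ledger crux ls
stmt-CriticalPhenomena-8253`: no workfiles at registration); `ledger negatives --problem
CriticalPhenomena` checked — the only SAW monotonicity-adjacent negative (stmt-0772, all-`δ` tightness) is
unrelated; no stub quantifies over meshes or asserts tightness.
-/

noncomputable section

open MeasureTheory Set
open Literature.Probability.RandomPlanarGeometry Literature.Probability.LatticeModels

namespace Summit.CriticalPhenomena.SAWScalingLimit.Cruxes.TargetMonotone.Birth

/-! ### Vocabulary of the line -/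

/-- The counter-clockwise quarter turn of `ℤ²`: `(x, y) ↦ (−y, x)`. -/
abbrev rot90 (v : Site 2) : Site 2 := ![-(v 1), v 0]

/-- The FIRST-DART INDEX of a chord from the source `a` attached at the boundary vertex `a*`: `k` if
its first vertex is `a + rot90^k (a* − a)` (`k = 1, 2, 3` counter-clockwise after the boundary dart),
junk `0` otherwise (never, for a chord of `Ω_δ`).  Inlined verbatim (as `if … then 1 else …`) in the
registered stub signatures. -/
abbrev dartIndex (a a' : Site 2) {Ω : Set ℂ} {δ : ℝ} {t : Site 2} (γ : SAW.DomainSAW Ω δ a t) : Fin 4 :=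
  if γ.walk.getVert 1 = a + rot90 (a' - a) then 1
  else if γ.walk.getVert 1 = a + rot90 (rot90 (a' - a)) then 2
  else if γ.walk.getVert 1 = a + rot90 (rot90 (rot90 (a' - a))) then 3 else 0

/-- **S1, named.** First-step order: over the crux's data class, the first dart of the chord to the
farther target `c` is stochastically larger (counter-clockwise from the boundary dart) than that of the
chord to `b`. -/
def FirstStepOrder : Prop :=
  ∀ (D : Literature.Probability.RandomPlanarGeometry.JordanDomain) (δ : ℝ) (a' b' c' a b c : Literature.Probability.LatticeModels.Site 2) (P : (Literature.Probability.LatticeModels.zdGraph 2).Walk a' b') (Q : (Literature.Probability.LatticeModels.zdGraph 2).Walk b' c') (R : (Literature.Probability.LatticeModels.zdGraph 2).Walk c' a') (hb : (Literature.Probability.LatticeModels.zdGraph 2).Adj b b') (hc : (Literature.Probability.LatticeModels.zdGraph 2).Adj c' c), let C := P.append (Q.append R); let Ω : Set ℂ := {z | Literature.Probability.RandomPlanarGeometry.Curve.wind ⟨C.toCurve (Literature.Probability.LatticeModels.meshPoint δ)⟩ z ≠ 0} ∩ D.carrier; let lft : Literature.Probability.LatticeModels.Site 2 → Literature.Probability.LatticeModels.Site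 2 → Literature.Probability.LatticeModels.Site 2 := fun u v => u + ![-(v 1 - u 1), v 0 - u 0]; 0 < δ → P.IsPath → Q.IsPath → R.IsPath → a' ∉ Q.support → b' ∉ R.support → c' ∉ P.support → (∀ z : ℂ, Literature.Probability.RandomPlanarGeometry.Curve.wind ⟨C.toCurve (Literature.Probability.LatticeModels.meshPoint δ)⟩ z = 0 ∨ Literature.Probability.RandomPlanarGeometry.Curve.wind ⟨C.toCurve (Literature.Probability.LatticeModels.meshPoint δ)⟩ z = 1) → (a = lft a' (P.getVert 1) ∨ a = a' + (a' - P.getVert 1)) → (b = lft b' (Q.getVert 1) ∨ b = b' + (b' - Q.getVert 1)) → (c = lft c' (R.getVert 1) ∨ c = c' + (c' - R.getVert 1)) → a ≠ b → a ≠ c → b ≠ c → (Literature.Probability.LatticeModels.discreteDomainGraph Ω δ).Reachable a b → (Literature.Probability.LatticeModels.discreteDomainGraph Ω δ).Reachable a c → let rot : Literature.Probability.LatticeModels.Site 2 → Literature.Probability.LatticeModels.Site 2 := fun v => ![-(v 1), v 0]; let ib : Literature.Probability.RandomPlanarGeometry.SAW.DomainSAW Ω δ a b → Fin 4 := fun γ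 => if γ.walk.getVert 1 = a + rot (a' - a) then 1 else if γ.walk.getVert 1 = a + rot (rot (a' - a)) then 2 else if γ.walk.getVert 1 = a + rot (rot (rot (a' - a))) then 3 else 0; let ic : Literature.Probability.RandomPlanarGeometry.SAW.DomainSAW Ω δ a c → Fin 4 := fun γ' => if γ'.walk.getVert 1 = a + rot (a' - a) then 1 else if γ'.walk.getVert 1 = a + rot (rot (a' - a)) then 2 else if γ'.walk.getVert 1 = a + rot (rot (rot (a' - a))) then 3 else 0; ∀ k : Fin 4, Literature.Probability.RandomPlanarGeometry.SAW.law Ω δ a b {γ | k ≤ ib γ} ≤ Literature.Probability.RandomPlanarGeometry.SAW.law Ω δ a c {γ' | k ≤ ic γ'}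

/-- **S2, named.** Tail order: over the crux's data class, for dart indices `i ≤ j` the conditional
chord laws given the first darts are ordered along `SAW.WeaklyBeyond (SAW.latticeConnector δ Q)`, in
cross-multiplied Hall form. -/
def TailOrder : Prop :=
  ∀ (D : Literature.Probability.RandomPlanarGeometry.JordanDomain) (δ : ℝ) (a' b' c' a b c : Literature.Probability.LatticeModels.Site 2) (P : (Literature.Probability.LatticeModels.zdGraph 2).Walk a' b') (Q : (Literature.Probability.LatticeModels.zdGraph 2).Walk b' c') (R : (Literature.Probability.LatticeModels.zdGraph 2).Walk c' a') (hb : (Literature.Probability.LatticeModels.zdGraph 2).Adj b b') (hc : (Literature.Probability.LatticeModels.zdGraph 2).Adj c' c), let C := P.append (Q.append R); let Ω : Set ℂ := {z | Literature.Probability.RandomPlanarGeometry.Curve.wind ⟨C.toCurve (Literature.Probability.LatticeModels.meshPoint δ)⟩ z ≠ 0} ∩ D.carrier; let lft : Literature.Probability.LatticeModels.Site 2 → Literature.Probability.LatticeModels.Site 2 → Literature.Probability.LatticeModels.Site 2 := fun u v => u + ![-(v 1 - u 1), v 0 - u 0]; 0 < δ → P.IsPath → Q.IsPath → R.IsPath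 → a' ∉ Q.support → b' ∉ R.support → c' ∉ P.support → (∀ z : ℂ, Literature.Probability.RandomPlanarGeometry.Curve.wind ⟨C.toCurve (Literature.Probability.LatticeModels.meshPoint δ)⟩ z = 0 ∨ Literature.Probability.RandomPlanarGeometry.Curve.wind ⟨C.toCurve (Literature.Probability.LatticeModels.meshPoint δ)⟩ z = 1) → (a = lft a' (P.getVert 1) ∨ a = a' + (a' - P.getVert 1)) → (b = lft b' (Q.getVert 1) ∨ b = b' + (b' - Q.getVert 1)) → (c = lft c' (R.getVert 1) ∨ c = c' + (c' - R.getVert 1)) → a ≠ b → a ≠ c → b ≠ c → (Literature.Probability.LatticeModels.discreteDomainGraph Ω δ).Reachable a b → (Literature.Probability.LatticeModels.discreteDomainGraph Ω δ).Reachable a c → let rot : Literature.Probability.LatticeModels.Site 2 → Literature.Probability.LatticeModels.Site 2 := fun v => ![-(v 1), v 0]; let ib : Literature.Probability.RandomPlanarGeometry.SAW.DomainSAW Ω δ a b → Fin 4 := fun γ => if γ.walk.getVert 1 = a + rot (a' - a) then 1 else if γ.walk.getVert 1 = a + rot (rot (a' - a)) then 2 else if γ.walk.getVert 1 = a + rot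 (rot (rot (a' - a))) then 3 else 0; let ic : Literature.Probability.RandomPlanarGeometry.SAW.DomainSAW Ω δ a c → Fin 4 := fun γ' => if γ'.walk.getVert 1 = a + rot (a' - a) then 1 else if γ'.walk.getVert 1 = a + rot (rot (a' - a)) then 2 else if γ'.walk.getVert 1 = a + rot (rot (rot (a' - a))) then 3 else 0; ∀ i j : Fin 4, i ≤ j → ∀ A : Set (Literature.Probability.RandomPlanarGeometry.SAW.DomainSAW Ω δ a b), A ⊆ ib ⁻¹' {i} → Literature.Probability.RandomPlanarGeometry.SAW.law Ω δ a b A * Literature.Probability.RandomPlanarGeometry.SAW.law Ω δ a c (ic ⁻¹' {j}) ≤ Literature.Probability.RandomPlanarGeometry.SAW.law Ω δ a c ({γ' | ∃ γ ∈ A, Literature.Probability.RandomPlanarGeometry.SAW.WeaklyBeyond (Literature.Probability.RandomPlanarGeometry.SAW.latticeConnector δ Q) γ γ'} ∩ ic ⁻¹' {j}) * Literature.Probability.RandomPlanarGeometry.SAW.law Ω δ a b (ib ⁻¹' {i})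

/-- **S3, named.** The monotone mixture lemma for `StochDominatedAlong` over finite fibrations of two
discrete finite measure spaces by `Fin n` (Karlin's order-preservation step in Hall form). -/
def MonotoneMixture : Prop :=
  ∀ {α β : Type} [MeasurableSpace α] [MeasurableSpace β] [DiscreteMeasurableSpace α] [DiscreteMeasurableSpace β] {n : ℕ} (R : α → β → Prop) (μ : MeasureTheory.Measure α) (ν : MeasureTheory.Measure β) (f : α → Fin n) (g : β → Fin n), μ Set.univ ≠ ⊤ → ν Set.univ ≠ ⊤ → (∀ k : Fin n, μ {x | k ≤ f x} ≤ ν {y | k ≤ g y}) → (∀ i j : Fin n, i ≤ j → ∀ A : Set α, A ⊆ f ⁻¹' {i} → μ A * ν (g ⁻¹' {j}) ≤ ν ({y | ∃ x ∈ A, R x y} ∩ g ⁻¹' {j}) * μ (f ⁻¹' {i})) → Literature.Probability.RandomPlanarGeometry.StochDominatedAlong R μ ν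

/-! ### The stubs (the ONLY `sorry`s of this file), in tree vocabulary -/

/-- **S1 — first-step order (the TP₂ input).** For every member of the crux's data class and every
`k : Fin 4`, `law Ω δ a b {dart index ≥ k} ≤ law Ω δ a c {dart index ≥ k}`.  Tail-sum consequence of
the boundary 2×2 minors `Z(a+dᵢ→b)Z(a+dⱼ→c) ≥ Z(a+dᵢ→c)Z(a+dⱼ→b)` (`i < j`) in `Ω_δ ∖ {a}` — the
relabelled instance `(a+dᵢ, b, c, a+dⱼ)` of `SAWTotalPositivity.BoundaryTP2` (stmt-7115) plus the
interlacing lemma and reversal symmetry of `SAW.weight`; both laws have total mass `1` (or both `0`). -/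
theorem stub_firstStepOrder :
    ∀ (D : Literature.Probability.RandomPlanarGeometry.JordanDomain) (δ : ℝ) (a' b' c' a b c : Literature.Probability.LatticeModels.Site 2) (P : (Literature.Probability.LatticeModels.zdGraph 2).Walk a' b') (Q : (Literature.Probability.LatticeModels.zdGraph 2).Walk b' c') (R : (Literature.Probability.LatticeModels.zdGraph 2).Walk c' a') (hb : (Literature.Probability.LatticeModels.zdGraph 2).Adj b b') (hc : (Literature.Probability.LatticeModels.zdGraph 2).Adj c' c), let C := P.append (Q.append R); let Ω : Set ℂ := {z | Literature.Probability.RandomPlanarGeometry.Curve.wind ⟨C.toCurve (Literature.Probability.LatticeModels.meshPoint δ)⟩ z ≠ 0} ∩ D.carrier; let lft : Literature.Probability.LatticeModels.Site 2 → Literature.Probability.LatticeModels.Site 2 → Literature.Probability.LatticeModels.Site 2 := fun u v => u + ![-(v 1 - u 1), v 0 - u 0]; 0 < δ → P.IsPath → Q.IsPath → R.IsPath → a' ∉ Q.support → b' ∉ R.support → c' ∉ P.support → (∀ z : ℂ, Literature.Probability.RandomPlanarGeometry.Curve.wind ⟨C.toCurve (Literature.Probability.LatticeModels.meshPoint δ)⟩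 z = 0 ∨ Literature.Probability.RandomPlanarGeometry.Curve.wind ⟨C.toCurve (Literature.Probability.LatticeModels.meshPoint δ)⟩ z = 1) → (a = lft a' (P.getVert 1) ∨ a = a' + (a' - P.getVert 1)) → (b = lft b' (Q.getVert 1) ∨ b = b' + (b' - Q.getVert 1)) → (c = lft c' (R.getVert 1) ∨ c = c' + (c' - R.getVert 1)) → a ≠ b → a ≠ c → b ≠ c → (Literature.Probability.LatticeModels.discreteDomainGraph Ω δ).Reachable a b → (Literature.Probability.LatticeModels.discreteDomainGraph Ω δ).Reachable a c → let rot : Literature.Probability.LatticeModels.Site 2 → Literature.Probability.LatticeModels.Site 2 := fun v => ![-(v 1), v 0]; let ib : Literature.Probability.RandomPlanarGeometry.SAW.DomainSAW Ω δ a b → Fin 4 := fun γ => if γ.walk.getVert 1 = a + rot (a' - a) then 1 else if γ.walk.getVert 1 = a + rot (rot (a' - a)) then 2 else if γ.walk.getVert 1 = a + rot (rot (rot (a' - a))) then 3 else 0; let ic : Literature.Probability.RandomPlanarGeometry.SAW.DomainSAW Ω δ a c → Fin 4 := fun γ' => if γ'.walk.getVert 1 = a + rot (a' - a) then 1 else if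 γ'.walk.getVert 1 = a + rot (rot (a' - a)) then 2 else if γ'.walk.getVert 1 = a + rot (rot (rot (a' - a))) then 3 else 0; ∀ k : Fin 4, Literature.Probability.RandomPlanarGeometry.SAW.law Ω δ a b {γ | k ≤ ib γ} ≤ Literature.Probability.RandomPlanarGeometry.SAW.law Ω δ a c {γ' | k ≤ ic γ'} := by
  sorry

/-- **S2 — tail order (HARDEST; the recursion invariant).** For dart indices `i ≤ j` and every
`A ⊆ {index = i}`: `law_{a,b}(A) · law_{a,c}{index = j} ≤ law_{a,c}(beyond[A] ∩ {index = j}) · law_{a,b}{index = i}`.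
Diagonal `i = j`: target monotonicity of the slit domain `Ω ∖ [a*, a]` from `a + dᵢ` (domain Markov,
one vertex down); off-diagonal `i < j`: its two-source companion across the spike (non-crossing
pairing `a+dᵢ → b`, `a+dⱼ → c`). -/
theorem stub_tailOrder :
    ∀ (D : Literature.Probability.RandomPlanarGeometry.JordanDomain) (δ : ℝ) (a' b' c' a b c : Literature.Probability.LatticeModels.Site 2) (P : (Literature.Probability.LatticeModels.zdGraph 2).Walk a' b') (Q : (Literature.Probability.LatticeModels.zdGraph 2).Walk b' c') (R : (Literature.Probability.LatticeModels.zdGraph 2).Walk c' a') (hb : (Literature.Probability.LatticeModels.zdGraph 2).Adj b b') (hc : (Literature.Probability.LatticeModels.zdGraph 2).Adj c' c), let C := P.append (Q.append R); let Ω : Set ℂ := {z | Literature.Probability.RandomPlanarGeometry.Curve.wind ⟨C.toCurve (Literature.Probability.LatticeModels.meshPoint δ)⟩ z ≠ 0} ∩ D.carrier; let lft : Literature.Probability.LatticeModels.Site 2 → Literature.Probability.LatticeModels.Site 2 → Literature.Probability.LatticeModels.Site 2 := fun u v => u + ![-(v 1 - u 1), v 0 - u 0]; 0 < δ → P.IsPath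 → Q.IsPath → R.IsPath → a' ∉ Q.support → b' ∉ R.support → c' ∉ P.support → (∀ z : ℂ, Literature.Probability.RandomPlanarGeometry.Curve.wind ⟨C.toCurve (Literature.Probability.LatticeModels.meshPoint δ)⟩ z = 0 ∨ Literature.Probability.RandomPlanarGeometry.Curve.wind ⟨C.toCurve (Literature.Probability.LatticeModels.meshPoint δ)⟩ z = 1) → (a = lft a' (P.getVert 1) ∨ a = a' + (a' - P.getVert 1)) → (b = lft b' (Q.getVert 1) ∨ b = b' + (b' - Q.getVert 1)) → (c = lft c' (R.getVert 1) ∨ c = c' + (c' - R.getVert 1)) → a ≠ b → a ≠ c → b ≠ c → (Literature.Probability.LatticeModels.discreteDomainGraph Ω δ).Reachable a b → (Literature.Probability.LatticeModels.discreteDomainGraph Ω δ).Reachable a c → let rot : Literature.Probability.LatticeModels.Site 2 → Literature.Probability.LatticeModels.Site 2 := fun v => ![-(v 1), v 0]; let ib : Literature.Probability.RandomPlanarGeometry.SAW.DomainSAW Ω δ a b → Fin 4 := fun γ => if γ.walk.getVert 1 = a + rot (a' - a) then 1 else if γ.walk.getVert 1 = a + rot (rot (a' - a)) then 2 else if γ.walk.getVert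 1 = a + rot (rot (rot (a' - a))) then 3 else 0; let ic : Literature.Probability.RandomPlanarGeometry.SAW.DomainSAW Ω δ a c → Fin 4 := fun γ' => if γ'.walk.getVert 1 = a + rot (a' - a) then 1 else if γ'.walk.getVert 1 = a + rot (rot (a' - a)) then 2 else if γ'.walk.getVert 1 = a + rot (rot (rot (a' - a))) then 3 else 0; ∀ i j : Fin 4, i ≤ j → ∀ A : Set (Literature.Probability.RandomPlanarGeometry.SAW.DomainSAW Ω δ a b), A ⊆ ib ⁻¹' {i} → Literature.Probability.RandomPlanarGeometry.SAW.law Ω δ a b A * Literature.Probability.RandomPlanarGeometry.SAW.law Ω δ a c (ic ⁻¹' {j}) ≤ Literature.Probability.RandomPlanarGeometry.SAW.law Ω δ a c ({γ' | ∃ γ ∈ A, Literature.Probability.RandomPlanarGeometry.SAW.WeaklyBeyond (Literature.Probability.RandomPlanarGeometry.SAW.latticeConnector δ Q) γ γ'} ∩ ic ⁻¹' {j}) * Literature.Probability.RandomPlanarGeometry.SAW.law Ω δ a b (ib ⁻¹' {i}) := by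
  sorry

/-- **S3 — monotone mixture lemma (provable now).** Finite measures `μ`, `ν` on discrete spaces fibred
over `Fin n` by `f`, `g`; fibre masses stochastically ordered; fibres cross-ordered along `R` for
`i ≤ j` (cross-multiplied Hall inequalities) ⇒ `StochDominatedAlong R μ ν`.  Elementary (Abel summation
with `m_k = min(1, min_{j ≥ k} ν(R[A] ∩ {g=j})/ν{g=j})`); no Strassen, no coupling. -/
theorem stub_monotoneMixture :
    ∀ {α β : Type} [MeasurableSpace α] [MeasurableSpace β] [DiscreteMeasurableSpace α] [DiscreteMeasurableSpace β] {n : ℕ} (R : α → β → Prop) (μ : MeasureTheory.Measure α) (ν : MeasureTheory.Measure β) (f : α → Fin n) (g : β → Fin n), μ Set.univ ≠ ⊤ → ν Set.univ ≠ ⊤ → (∀ k : Fin n, μ {x | k ≤ f x} ≤ ν {y | k ≤ g y}) → (∀ i j : Fin n, i ≤ j → ∀ A : Set α, A ⊆ f ⁻¹' {i} → μ A * ν (g ⁻¹' {j}) ≤ ν ({y | ∃ x ∈ A, R x y} ∩ g ⁻¹' {j}) * μ (f ⁻¹' {i})) → Literature.Probability.RandomPlanarGeometry.StochDominatedAlong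 R μ ν := by
  sorry

/-! ### Consistency: each named statement IS its stub (definitionally) -/

theorem firstStepOrder_holds : FirstStepOrder := stub_firstStepOrder
theorem tailOrder_holds : TailOrder := stub_tailOrder
theorem monotoneMixture_holds : MonotoneMixture := stub_monotoneMixture

/-! ### Name-keyed aliases of the three statements — the hypotheses of `TargetMonotone_of`

The skeleton audit (`#h21_check_skeleton`) admits a `Prop` hypothesis of the skeleton theorem only if its
head constant is a registered obligation or is NAMED like a declared stub; `Registered.stub_X` is the
statement of `stub_X` under that name (device of `Cruxes/ChainLaw/Lines/birth.lean`). -/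
namespace Registered

/-- Alias of `FirstStepOrder` keyed by the registered stub name. -/
abbrev stub_firstStepOrder : Prop := FirstStepOrder
/-- Alias of `TailOrder` keyed by the registered stub name. -/
abbrev stub_tailOrder : Prop := TailOrder
/-- Alias of `MonotoneMixture` keyed by the registered stub name. -/
abbrev stub_monotoneMixture : Prop := MonotoneMixture

end Registered

/-! ### Sorry-free glue -/

/-- Every set of chords is measurable (discrete σ-algebra `⊤` on `SAW.DomainSAW`). -/
instance instDiscreteMeasurableSpaceDomainSAW (Ω : Set ℂ) (δ : ℝ) (a b : Site 2) :
    DiscreteMeasurableSpace (SAW.DomainSAW Ω δ a b) :=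
  ⟨fun _ => MeasurableSpace.measurableSet_top⟩

/-- The total mass of `SAW.law` is `(Z)⁻¹ · Z ≤ 1`, in particular finite (all junk cases included). -/
theorem law_univ_ne_top (Ω : Set ℂ) (δ : ℝ) (a b : Site 2) : SAW.law Ω δ a b Set.univ ≠ ⊤ := by
  rw [SAW.law, Measure.smul_apply, smul_eq_mul]
  exact ne_top_of_le_ne_top ENNReal.one_ne_top (ENNReal.inv_mul_le_one _)

/-! ### The skeleton theorem: the three stubs imply the crux, BY NAME -/

/-- **`TargetMonotone` from the line `birth`** (kernel-checked, no `sorry` of its own): feed the crux's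
data and hypotheses to S1 (first-step order) and S2 (tail order), combine them by S3 (monotone mixture)
into `SAW.IsTargetOrdered Ω δ a b c (SAW.latticeConnector δ Q)`, and rewrite by the tree's
`SAW.isTargetOrdered_latticeConnector_iff` into the crux's inlined Hall inequalities. -/
theorem TargetMonotone_of (h₁ : Registered.stub_firstStepOrder) (h₂ : Registered.stub_tailOrder)
    (h₃ : Registered.stub_monotoneMixture) :
    Summit.CriticalPhenomena.SAWScalingLimit.Theses.SAWTargetMonotonicity.TargetMonotone := by
  intro D δ a' b' c' a b c P Q R hb hc
  dsimp only
  intro hδ hP hQ hR haQ hbR hcP hwind ha hbt hct hab hac hbc hrab hrac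
  have h1 := h₁ D δ a' b' c' a b c P Q R hb hc hδ hP hQ hR haQ hbR hcP hwind ha hbt hct hab hac hbc
    hrab hrac
  have h2 := h₂ D δ a' b' c' a b c P Q R hb hc hδ hP hQ hR haQ hbR hcP hwind ha hbt hct hab hac hbc
    hrab hrac
  dsimp only at h1 h2
  refine (SAW.isTargetOrdered_latticeConnector_iff _ hb hc Q).1 ?_
  exact h₃ (SAW.WeaklyBeyond (SAW.latticeConnector δ Q)) _ _ (dartIndex a a') (dartIndex a a')
    (law_univ_ne_top _ δ a b) (law_univ_ne_top _ δ a c) h1 h2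

/-- Wiring check (an `example`, so that `TargetMonotone_of` stays the only theorem concluding the crux):
the sorried stubs, with their tree-vocabulary types, feed the skeleton theorem as stated. -/
example : Summit.CriticalPhenomena.SAWScalingLimit.Theses.SAWTargetMonotonicity.TargetMonotone :=
  TargetMonotone_of stub_firstStepOrder stub_tailOrder stub_monotoneMixture

end Summit.CriticalPhenomena.SAWScalingLimit.Cruxes.TargetMonotone.Birth

end
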